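import Summits.PneNP.PneNP.Theorems.BruckRyserSosSosBlindPlanesFunctional

/-!
# PneNP / BruckRyserSos — squares and design identities under the moment functional

Route `PneNP/BruckRyserSos`, crux stmt-PneNP-16761 (`SosBlindPlanes`); continuation of file
`…Functional` (the functional `Efun v D μ` of a table `μ`).

* `Efun_mul_self_eq` / `Efun_mul_self_nonneg` — `E(p²) = cᵀ M c` for the moment matrix `M` of
  file `…Moments` and the coefficient vector `c` of `p` grouped by cell sets, hence `E(p²) ≥ 0`
  whenever `M ⪰ 0` and the monomials of `p` have at most `h` cells;
* `Efun_rowLin_mul`, `Efun_rowQuad_mul`, `Efun_colLin_mul`, `Efun_colQuad_mul` — the values of the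
  design identities (`Σ_B x_(p,B) = r`, `Σ_B x_(p,B) x_(p',B) = r`, and the column duals) times a
  monomial are the board sums `Σ_B tmom (U ∪ A × {B}) - r · tmom U` of file `…Identities` (so
  they vanish once the template identities hold).

References: Kothari–Mori–O'Donnell–Witmer (STOC 2017), Defs. 2.7–2.8; M. Laurent, Math. Oper.
Res. 28 (2003).
-/

set_option linter.dupNamespace false -- `Summit.PneNP.PneNP.…`: summit = sub-problem name (D-0017 single-conjunct layout)

noncomputable section

namespace Summit.PneNP.PneNP.Theorems.SosBlindPlanes

open Finset Function MvPolynomial Matrix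
open Literature.Computability.MetaComplexity

variable {v D : ℕ}

/-! ### Squares: `E (p²) = cᵀ M c` -/

/-- The index of the moment matrix attached to a monomial (junk if it has more than `h` cells).
[folklore] -/
def idxOf (v h : ℕ) (m : ℕ →₀ ℕ) : Idx v h :=
  if hm : (cellsOf v m).card ≤ h then ⟨cellsOf v m, hm⟩ else ⟨∅, by simp⟩

/-- The underlying configuration of `idxOf`. [folklore] -/
theorem idxOf_val {h : ℕ} {m : ℕ →₀ ℕ} (hm : (cellsOf v m).card ≤ h) :
    (idxOf v h m).1 = cellsOf v m := by
  simp [idxOf, hm]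

/-- The coefficient vector of `p` on the index set: `c_S = Σ_{m good, cells m = S} coeff m p`.
[folklore] -/
def cvec (v h : ℕ) (p : MvPolynomial ℕ ℝ) : Idx v h → ℝ :=
  fun S => ∑ m ∈ p.support, if idxOf v h m = S then (if Good v m then coeff m p else 0) else 0

/-- `E (p²)` coefficientwise. [folklore] -/
theorem Efun_mul_self (μ : Finset (Fin D × Fin D) → ℝ) (p : MvPolynomial ℕ ℝ) :
    Efun v D μ (p * p) = ∑ m ∈ p.support, ∑ m' ∈ p.support,
      coeff m p * coeff m' p * wt v D μ (m + m') := by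
  conv_lhs => rw [p.as_sum, sum_mul_sum, map_sum]
  refine sum_congr rfl fun m _ => ?_
  rw [map_sum]
  refine sum_congr rfl fun m' _ => ?_
  rw [monomial_mul, Efun_monomial]

/-- **`E (p²) = cᵀ M c`** for the moment matrix `M` and the coefficient vector `c` of `p`, when
the monomials of `p` have at most `h` cells. [Laurent 2003, §2] [folklore] -/
theorem Efun_mul_self_eq {h : ℕ} (μ : Finset (Fin D × Fin D) → ℝ) (p : MvPolynomial ℕ ℝ)
    (hp : ∀ m ∈ p.support, (cellsOf v m).card ≤ h) :
    Efun v D μ (p * p) =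
      cvec v h p ⬝ᵥ (momMatrix v D h μ *ᵥ cvec v h p) := by
  classical
  set M := momMatrix v D h μ with hM
  set F : (ℕ →₀ ℕ) → ℝ := fun m => if Good v m then coeff m p else 0 with hF
  set Y : (ℕ →₀ ℕ) → (ℕ →₀ ℕ) → Idx v h → Idx v h → ℝ := fun m m' S T =>
    (if idxOf v h m = S then F m else 0) * M S T * (if idxOf v h m' = T then F m' else 0) with hY
  -- (1) the left-hand side, monomial by monomial
  have h1 : Efun v D μ (p * p) =
      ∑ m ∈ p.support, ∑ m' ∈ p.support, F m * M (idxOf v h m) (idxOf v h m') * F m' := by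
    rw [Efun_mul_self]
    refine sum_congr rfl fun m hm => sum_congr rfl fun m' hm' => ?_
    rw [hM, momMatrix_apply, idxOf_val (hp m hm), idxOf_val (hp m' hm')]
    by_cases hg : Good v m
    · by_cases hg' : Good v m'
      · rw [wt_of_good ((good_add_iff m m').2 ⟨hg, hg'⟩), cellsOf_add]
        simp only [hF, hg, hg', if_true]
        ring
      · rw [wt_of_not_good (fun h' => hg' ((good_add_iff m m').1 h').2)]
        simp only [hF, hg', if_false]
        ring
    · rw [wt_of_not_good (fun h' => hg ((good_add_iff m m').1 h').1)]
      simp only [hF, hg, if_false]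
      ring
  -- (2) each such term as a double sum over index pairs
  have h4 : ∀ m m', F m * M (idxOf v h m) (idxOf v h m') * F m' = ∑ S, ∑ T, Y m m' S T := by
    intro m m'
    symm
    calc ∑ S, ∑ T, Y m m' S T
        = ∑ S, (if idxOf v h m = S then F m else 0) * M S (idxOf v h m') * F m' := by
          refine sum_congr rfl fun S _ => ?_
          have hT : ∀ T, Y m m' S T = if idxOf v h m' = T then
              (if idxOf v h m = S then F m else 0) * M S T * F m' else 0 := by
            intro T; simp only [hY]; split_ifs <;> ring
          rw [Fintype.sum_congr _ _ hT, Finset.sum_ite_eq]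
          simp
      _ = F m * M (idxOf v h m) (idxOf v h m') * F m' := by
          have hS : ∀ S, (if idxOf v h m = S then F m else 0) * M S (idxOf v h m') * F m' =
              if idxOf v h m = S then F m * M S (idxOf v h m') * F m' else 0 := by
            intro S; split_ifs <;> ring
          rw [Fintype.sum_congr _ _ hS, Finset.sum_ite_eq]
          simp
  -- (3) the right-hand side
  have h2 : cvec v h p ⬝ᵥ (M *ᵥ cvec v h p) =
      ∑ S, ∑ T, cvec v h p S * M S T * cvec v h p T := by
    simp only [dotProduct, Matrix.mulVec, Finset.mul_sum, mul_assoc]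
  have h3 : ∀ S T, cvec v h p S * M S T * cvec v h p T =
      ∑ m ∈ p.support, ∑ m' ∈ p.support, Y m m' S T := by
    intro S T
    simp only [cvec, hY, hF]
    rw [sum_mul, sum_mul]
    refine sum_congr rfl fun m _ => ?_
    rw [Finset.mul_sum]
  -- (4) exchange the order of summation (two outer sums past two inner ones)
  rw [h1, h2]
  simp only [h4, h3]
  calc ∑ m ∈ p.support, ∑ m' ∈ p.support, ∑ S, ∑ T, Y m m' S T
      = ∑ m ∈ p.support, ∑ S, ∑ m' ∈ p.support, ∑ T, Y m m' S T :=
        sum_congr rfl fun _ _ => Finset.sum_comm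
    _ = ∑ S, ∑ m ∈ p.support, ∑ m' ∈ p.support, ∑ T, Y m m' S T := Finset.sum_comm
    _ = ∑ S, ∑ m ∈ p.support, ∑ T, ∑ m' ∈ p.support, Y m m' S T :=
        sum_congr rfl fun _ _ => sum_congr rfl fun _ _ => Finset.sum_comm
    _ = ∑ S, ∑ T, ∑ m ∈ p.support, ∑ m' ∈ p.support, Y m m' S T :=
        sum_congr rfl fun _ _ => Finset.sum_comm

/-- **Positivity of squares from positive semidefiniteness of the moment matrix.** [folklore] -/
theorem Efun_mul_self_nonneg {h : ℕ} (μ : Finset (Fin D × Fin D) → ℝ)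
    (hM : (momMatrix v D h μ).PosSemidef) (p : MvPolynomial ℕ ℝ)
    (hp : ∀ m ∈ p.support, (cellsOf v m).card ≤ h) : 0 ≤ Efun v D μ (p * p) := by
  rw [Efun_mul_self_eq μ p hp]
  have := (Matrix.posSemidef_iff_dotProduct_mulVec.1 hM).2 (cvec v h p)
  simpa using this

/-! ### The design identities times a monomial -/

/-- Multiplying a polynomial identity by a scalar multiple of a monomial. [folklore] -/
theorem Efun_mul_eq_zero_of_monomial (μ : Finset (Fin D × Fin D) → ℝ) (q r : MvPolynomial ℕ ℝ)
    (h : ∀ m ∈ r.support, Efun v D μ (q * monomial m 1) = 0) : Efun v D μ (q * r) = 0 := by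
  rw [r.as_sum, mul_sum, map_sum]
  refine sum_eq_zero fun m hm => ?_
  have : monomial m (coeff m r) = coeff m r • monomial m (1 : ℝ) := by
    rw [smul_monomial, smul_eq_mul, mul_one]
  rw [this, mul_smul_comm, map_smul, h m hm, smul_zero]

/-- The value of `X_c · X^m` for a board cell `c`. [folklore] -/
theorem Efun_X_mul_monomial (μ : Finset (Fin D × Fin D) → ℝ) (c : Fin v × Fin v) (m : ℕ →₀ ℕ) :
    Efun v D μ (X (cellIx c) * monomial m 1) =
      if Good v m then tmom D μ (insert c (cellsOf v m)) else 0 := by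
  rw [X, monomial_mul, Efun_monomial, one_mul, one_mul, add_comm]
  by_cases hg : Good v m
  · rw [if_pos hg, wt_of_good ((good_add_single_iff m c one_ne_zero).2 hg),
      cellsOf_add_single m c one_ne_zero]
  · rw [if_neg hg, wt_of_not_good (fun h' => hg ((good_add_single_iff m c one_ne_zero).1 h'))]

/-- The value of `X_c · X_c' · X^m` for board cells `c, c'`. [folklore] -/
theorem Efun_X_mul_X_mul_monomial (μ : Finset (Fin D × Fin D) → ℝ) (c c' : Fin v × Fin v)
    (m : ℕ →₀ ℕ) :
    Efun v D μ (X (cellIx c) * X (cellIx c') * monomial m 1) =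
      if Good v m then tmom D μ (insert c (insert c' (cellsOf v m))) else 0 := by
  rw [mul_assoc, X, X, monomial_mul, monomial_mul, Efun_monomial, one_mul, one_mul, one_mul]
  have hm : Finsupp.single (cellIx c) 1 + (Finsupp.single (cellIx c') 1 + m) =
      (m + Finsupp.single (cellIx c') 1) + Finsupp.single (cellIx c) 1 := by abel
  rw [hm]
  by_cases hg : Good v m
  · rw [if_pos hg, wt_of_good, cellsOf_add_single _ c one_ne_zero,
      cellsOf_add_single m c' one_ne_zero]
    exact (good_add_single_iff _ c one_ne_zero).2 ((good_add_single_iff m c' one_ne_zero).2 hg)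
  · rw [if_neg hg, wt_of_not_good]
    intro h'
    exact hg ((good_add_single_iff m c' one_ne_zero).1
      ((good_add_single_iff _ c one_ne_zero).1 h'))

/-- The value of `X^m` itself. [folklore] -/
theorem Efun_monomial_one (μ : Finset (Fin D × Fin D) → ℝ) (m : ℕ →₀ ℕ) :
    Efun v D μ (monomial m 1) = if Good v m then tmom D μ (cellsOf v m) else 0 := by
  rw [Efun_monomial, one_mul]
  by_cases hg : Good v m
  · rw [if_pos hg, wt_of_good hg]
  · rw [if_neg hg, wt_of_not_good hg]

/-- **Row-sum identity times a monomial**: `E ((Σ_B x_(p,B) - r) X^m)` is the board sum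
`Σ_B tmom (U ∪ {p} × {B}) - r · tmom U`, `U` the cells of `m` (and `0` if `m` is not good).
[folklore] -/
theorem Efun_rowLin_mul (μ : Finset (Fin D × Fin D) → ℝ) (p : Fin v) (r : ℝ) (m : ℕ →₀ ℕ) :
    Efun v D μ (((∑ B : Fin v, X (cellIx (p, B))) - C r) * monomial m 1) =
      if Good v m then
        (∑ B : Fin v, tmom D μ (addLine (cellsOf v m) {p} B)) - r * tmom D μ (cellsOf v m)
      else 0 := by
  rw [sub_mul, map_sub, sum_mul, map_sum, C_mul_monomial, Efun_monomial, mul_one]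
  simp only [Efun_X_mul_monomial]
  by_cases hg : Good v m
  · simp only [hg, if_true, wt_of_good hg]
    congr 1
    refine sum_congr rfl fun B _ => ?_
    congr 1
    simp [addLine]
  · simp [hg, wt_of_not_good hg]

/-- **Row inner-product identity times a monomial** (`p ≠ p'`):
`E ((Σ_B x_(p,B) x_(p',B) - r) X^m) = Σ_B tmom (U ∪ {p, p'} × {B}) - r · tmom U`. [folklore] -/
theorem Efun_rowQuad_mul (μ : Finset (Fin D × Fin D) → ℝ) (p p' : Fin v) (r : ℝ) (m : ℕ →₀ ℕ) :
    Efun v D μ (((∑ B : Fin v, X (cellIx (p, B)) * X (cellIx (p', B))) - C r) * monomial m 1) =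
      if Good v m then
        (∑ B : Fin v, tmom D μ (addLine (cellsOf v m) {p, p'} B)) - r * tmom D μ (cellsOf v m)
      else 0 := by
  rw [sub_mul, map_sub, sum_mul, map_sum, C_mul_monomial, Efun_monomial, mul_one]
  simp only [Efun_X_mul_X_mul_monomial]
  by_cases hg : Good v m
  · simp only [hg, if_true, wt_of_good hg]
    congr 1
    refine sum_congr rfl fun B _ => ?_
    congr 1
    ext c
    simp only [addLine, mem_insert, mem_union, mem_product, mem_singleton]
    constructor
    · rintro (rfl | rfl | h)
      · exact Or.inr ⟨Or.inl rfl, rfl⟩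
      · exact Or.inr ⟨Or.inr rfl, rfl⟩
      · exact Or.inl h
    · rintro (h | ⟨rfl | rfl, h2⟩)
      · exact Or.inr (Or.inr h)
      · left; ext <;> simp [h2]
      · right; left; ext <;> simp [h2]
  · simp [hg, wt_of_not_good hg]

/-- **Column-sum identity times a monomial**:
`E ((Σ_p x_(p,B) - r) X^m) = Σ_p tmom (U ∪ {p} × {B}) - r · tmom U`. [folklore] -/
theorem Efun_colLin_mul (μ : Finset (Fin D × Fin D) → ℝ) (B : Fin v) (r : ℝ) (m : ℕ →₀ ℕ) :
    Efun v D μ (((∑ p : Fin v, X (cellIx (p, B))) - C r) * monomial m 1) =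
      if Good v m then
        (∑ p : Fin v, tmom D μ (addCol (cellsOf v m) {B} p)) - r * tmom D μ (cellsOf v m)
      else 0 := by
  rw [sub_mul, map_sub, sum_mul, map_sum, C_mul_monomial, Efun_monomial, mul_one]
  simp only [Efun_X_mul_monomial]
  by_cases hg : Good v m
  · simp only [hg, if_true, wt_of_good hg]
    congr 1
    refine sum_congr rfl fun p _ => ?_
    congr 1
    simp [addCol]
  · simp [hg, wt_of_not_good hg]

/-- **Column inner-product identity times a monomial** (`B ≠ B'`):
`E ((Σ_p x_(p,B) x_(p,B') - r) X^m) = Σ_p tmom (U ∪ {p} × {B, B'}) - r · tmom U`. [folklore] -/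
theorem Efun_colQuad_mul (μ : Finset (Fin D × Fin D) → ℝ) (B B' : Fin v) (r : ℝ) (m : ℕ →₀ ℕ) :
    Efun v D μ (((∑ p : Fin v, X (cellIx (p, B)) * X (cellIx (p, B'))) - C r) * monomial m 1) =
      if Good v m then
        (∑ p : Fin v, tmom D μ (addCol (cellsOf v m) {B, B'} p)) - r * tmom D μ (cellsOf v m)
      else 0 := by
  rw [sub_mul, map_sub, sum_mul, map_sum, C_mul_monomial, Efun_monomial, mul_one]
  simp only [Efun_X_mul_X_mul_monomial]
  by_cases hg : Good v m
  · simp only [hg, if_true, wt_of_good hg]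
    congr 1
    refine sum_congr rfl fun p _ => ?_
    congr 1
    ext c
    simp only [addCol, mem_insert, mem_union, mem_product, mem_singleton]
    constructor
    · rintro (rfl | rfl | h)
      · exact Or.inr ⟨rfl, Or.inl rfl⟩
      · exact Or.inr ⟨rfl, Or.inr rfl⟩
      · exact Or.inl h
    · rintro (h | ⟨h1, rfl | rfl⟩)
      · exact Or.inr (Or.inr h)
      · left; ext <;> simp [h1]
      · right; left; ext <;> simp [h1]
  · simp [hg, wt_of_not_good hg]

end Summit.PneNP.PneNP.Theorems.SosBlindPlanes
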